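import Literature.Analysis.FluidPDE.ElgindiSelfSimilarExponent
import HarnessLib
/-!
# The KILL-side of the Elgindi branch is row-independent: `c_l = (1+δ)/α_E > ½` (indeed `> 2`) on the whole
# admissible range `0 < α_E < ½` as soon as `δ > −¾` (resp. `δ ≥ 0`) — real algebra behind the Z6 census sentence

HONEST FRAMING (cell ns-blowup GROUP B «PROFILE SEARCH», zone Z6 «Elgindi-type C^{1,α} no-swirl self-similar blow-up»;
human rulings D-0035/D-0074/D-0081; census file HOME/profile/z6/CENSUS-Z6.md v1): **real algebra and exponent
bookkeeping** about the ν = 0 axisymmetric NO-SWIRL **EULER** profile family in Elgindi's `(z, θ)` gauge (tree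
`Literature.Analysis.FluidPDE.Elgindi.IsProfile α δ F Φ`; physical collapse exponent
`Literature.Analysis.FluidPDE.Elgindi.collapseExponent α δ = (1+δ)/α`, the census's `c_l`). Not Navier–Stokes;
«violates: none — MODEL (Euler)». Nothing here asserts that a profile exists at any `(α, δ)`.

WHY THIS FILE. The Z6 zone sentence (profile-lead RULINGS (bs)(2)/(ge)(4)(a), Z3-b′ mould) reads «on the Elgindi branch
… c_l = (1+δ)/α_E ∈ [9.71, 102.7] ∌ ½ ⇒ KILL-side (K+) on the family (MODEL/Euler-qualified; hooks
`tendsto_effectiveViscosity_atTop_of_half_lt` + W2)», where the hypothesis `½ < c_l` of the hook was so far discharged ROW BY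
ROW from the engines' float64 numbers, and the tree's own kernel version
(`Elgindi.half_lt_collapseExponent`, `Elgindi.tendsto_effectiveViscosity_atTop`) covers only Elgindi's perturbative range
`α < 1/(|C|+1)` under the named fact `|δ| ≤ Cα`. The profile-refuter's K-read of the Z6-0 memo (KILLSHEET-B-Z58 §3.3,
PS6-0) put the finite-α gap exactly: «on the finite-α_E stretch the sentence rests on λ(α_E) > α_E(½ + δ_kill) − 1 …, i.e. on
the UNPRINTED size of λ(α_E)». WHAT IS KERNEL-CHECKED HERE closes that gap uniformly in the one quantity the table does
print — the SIGN / lower bound of `δ`: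
* `half_lt_collapseExponent_iff`, `lt_collapseExponent_iff`: for `α > 0`, `k < (1+δ)/α ↔ kα − 1 < δ`; in particular
  `½ < c_l ↔ α/2 − 1 < δ`;
* `half_lt_collapseExponent_of_lt_half`: `0 < α < ½` and `−¾ ≤ δ` ⇒ `½ < c_l` — i.e. on the WHOLE admissible range of the
  Elgindi class (axis vanishing order `2α/3 < ⅓`, the Ukhovskii–Yudovich/Danchin wall of `AxisymNoSwirlHolderThreshold.lean`,
  see `axisOrder_lt_third_iff`) every collapsing profile with `δ ≥ −¾` is KILL-side, whatever the (unknown) function `δ(α)`;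
  `two_lt_collapseExponent_of_lt_half` (`δ ≥ 0` ⇒ `c_l > 2`, the registered pre-statement P-Z6-4's inequality) and
  `one_lt_collapseExponent_of_lt_half` (`δ ≥ −½` ⇒ `c_l > 1`, bounded velocity) likewise;
* `tendsto_effectiveViscosity_atTop_of_lt_half`, `tendsto_velocityScale_zero_of_lt_half`: the census hooks instantiated
  uniformly (ν_eff → +∞, velocity scale → 0) — the class-E analogue of
  `AxisModelExponentDictionary.tendsto_effectiveViscosity_axisModel_atTop` for the 1-D axis MODEL;
* `axisOrder_lt_third_iff`: `2α/3 < ⅓ ↔ α < ½` (the dictionary between the Hölder-axis wall `⅓` and the `α_E` axis);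
* `cornerThreshold_lt_half`: the characteristic-reversal threshold `α_f(δ) = (1+δ)/(2(2+δ))` of
  `ElgindiGaugeCornerSpeed.cornerSpeed_E_pos_iff` is `< ½` for every `δ > −2` — the identity that closes the «no reversal»
  bracket from above in the lead's letter (ee)(2)(e2) («no 0.50 row needed»);
* `cornerSpeed_E_pos_iff_delta`, `one_lt_reversalRatio_iff`: for `α < ½` the axis-corner speed `(1+δ) − 2α(2+δ)` is
  positive iff `(4α−1)/(1−2α) < δ`, and for `¼ < α < ½` iff the «reversal ratio» `δ/((4α−1)/(1−2α))` printed per row by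
  engine A exceeds `1` (refuter pre-statement P-Z6-10, first clause; census §1b column);
* `farFieldExponent_eq_inv_collapseExponent`: the far-field decay exponent `α/(1+δ)` of the profile (`F ∼ z^{−1/(1+δ)}`,
  `z = ρ^α`) is `1/c_l` (SHEET §1.A «FAR FIELD», print n4; a formal identity).
THE TABLE'S INPUT (HOME/profile/z6/runs/Q1-MASTER-TABLE.txt 08cd918cbcde48e4, QD-TABLE-job1/2): every computed row has
`δ ≥ 0.0275 > 0` and `α_E ≤ 0.437 < ½`; with this file the K+ clause of the zone sentence needs only those two signs, not
the per-row quotient. WHAT IS NOT PROVED: that `δ(α) ≥ 0` (or `> −¾`) along the branch — that is the engines' MODEL datum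
(two codes at α_E 0.05/0.25/0.30/0.35, one code elsewhere), not a theorem; existence of profiles at finite `α`; anything
about Navier–Stokes. PLACEMENT: cell-own MODEL/Euler-gauge lemma file next to `ElgindiGaugeCornerSpeed` (eng-10) —
profile-eng-9 g2; bears on LADDER-NS N5 / zone Z6 → N1 linear core (census hook custody).
-/

noncomputable section

open Filter Real
open _root_.Topology
open Literature.Analysis.FluidPDE

namespace Summit.NavierStokesRegularity.OSWSelfSimilar
namespace ElgindiBranchKillSide

/-! ### The collapse exponent against a threshold: one linear inequality in `δ` -/

/-- **Threshold dictionary.** For `α > 0` and any level `k`, `k < c_l = (1+δ)/α` iff `kα − 1 < δ`.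
[new here — MODEL/Euler exponent bookkeeping; Elgindi 2021 Remark 1.3 (arXiv:1904.04795 p. 4) for `c_l = (1+δ)/α`] -/
theorem lt_collapseExponent_iff {α : ℝ} (hα : 0 < α) (k δ : ℝ) :
    k < Elgindi.collapseExponent α δ ↔ k * α - 1 < δ := by
  rw [Elgindi.collapseExponent_apply, lt_div_iff₀ hα]
  constructor <;> intro h <;> linarith

/-- **The parabolic threshold.** For `α > 0`: `½ < c_l ↔ α/2 − 1 < δ` (the refuter's PS6-0 form «NS relevance needs
`δ(α) ≤ α/2 − 1`», KILLSHEET-B-Z58 §3.2/§3.3). [new here — MODEL/Euler exponent bookkeeping] -/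
theorem half_lt_collapseExponent_iff {α : ℝ} (hα : 0 < α) (δ : ℝ) :
    1 / 2 < Elgindi.collapseExponent α δ ↔ α / 2 - 1 < δ := by
  rw [lt_collapseExponent_iff hα]
  constructor <;> intro h <;> linarith

/-- **KILL-side on the whole admissible range.** If `0 < α < ½` (the Elgindi class is blow-up-admissible only there:
axis order `2α/3 < ⅓`, `axisOrder_lt_third_iff`) and `δ ≥ −¾`, then `c_l = (1+δ)/α > ½`. In particular every row of the
Z6 table (all with `δ > 0`) is KILL-side independently of its digits. [new here — MODEL/Euler exponent bookkeeping; Z6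
census hook custody] -/
theorem half_lt_collapseExponent_of_lt_half {α δ : ℝ} (hα : 0 < α) (hα2 : α < 1 / 2) (hδ : -(3 / 4) ≤ δ) :
    1 / 2 < Elgindi.collapseExponent α δ := by
  rw [half_lt_collapseExponent_iff hα]
  linarith

/-- **Bounded velocity on the admissible range**: `0 < α < ½`, `δ ≥ −½` ⇒ `c_l > 1` (velocity scale `(T−t)^{c_l−1} → 0`,
cf. `Elgindi.tendsto_velocityScale_zero`). [new here — MODEL/Euler exponent bookkeeping] -/
theorem one_lt_collapseExponent_of_lt_half {α δ : ℝ} (hα : 0 < α) (hα2 : α < 1 / 2) (hδ : -(1 / 2) ≤ δ) :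
    1 < Elgindi.collapseExponent α δ := by
  rw [lt_collapseExponent_iff hα]
  linarith

/-- **P-Z6-4's inequality, uniformly**: `0 < α < ½`, `δ ≥ 0` ⇒ `c_l > 2` (registered pre-statement P-Z6-4 «c_l(α_E) =
(1+δ)/α_E > 2 on the whole computed branch», scored MET row by row; here it follows from the two signs alone).
[new here — MODEL/Euler exponent bookkeeping] -/
theorem two_lt_collapseExponent_of_lt_half {α δ : ℝ} (hα : 0 < α) (hα2 : α < 1 / 2) (hδ : 0 ≤ δ) :
    2 < Elgindi.collapseExponent α δ := by
  rw [lt_collapseExponent_iff hα]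
  linarith

/-- **The W1 dictionary**: the Elgindi-class vorticity vanishes to order `2α/3` at the axis (weight
`(sin θ cos²θ)^{α/3}`, `ElgindiGaugeCornerSpeed.classE_weight_split`), and `2α/3 < ⅓ ↔ α < ½` — the Hölder-axis wall `⅓`
(`Literature.Analysis.FluidPDE.holderExponent_trichotomy_third`) read on the `α_E` axis. [new here — MODEL/Euler
exponent bookkeeping; Z6 SHEET v1 §0.1] -/
theorem axisOrder_lt_third_iff (α : ℝ) : 2 * α / 3 < 1 / 3 ↔ α < 1 / 2 := by
  constructor <;> intro h <;> linarith

/-! ### The census hooks, instantiated uniformly on the admissible range -/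

/-- **Viscosity is dominant along every admissible Elgindi-branch collapse**: for `0 < α < ½`, `δ ≥ −¾` and `ν > 0` the
effective viscosity `ν_eff(t) = ν(T−t)^{1−2c_l}` of the power-law collapse ansatz with exponent `c_l = (1+δ)/α` tends to
`+∞` as `t ↑ T` — the tree's `tendsto_effectiveViscosity_atTop_of_half_lt` at `γ = c_l`, uniformly in the row. Exponent
bookkeeping only; no NS solution is asserted. [new here — MODEL/Euler exponent bookkeeping; census hook H1/M8 class] -/
theorem tendsto_effectiveViscosity_atTop_of_lt_half {α δ ν : ℝ} (T : ℝ) (hα : 0 < α) (hα2 : α < 1 / 2)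
    (hδ : -(3 / 4) ≤ δ) (hν : 0 < ν) :
    Tendsto (effectiveViscosity ν (Elgindi.collapseExponent α δ) T) (𝓝[<] T) atTop :=
  tendsto_effectiveViscosity_atTop_of_half_lt (half_lt_collapseExponent_of_lt_half hα hα2 hδ) hν

/-- **The velocity amplitude vanishes along every admissible Elgindi-branch collapse** (`0 < α < ½`, `δ ≥ −½`): the
velocity scale `(T−t)^{c_l−1}` of the ansatz tends to `0` as `t ↑ T` — an energy-NON-concentrating, super-parabolic
collapse, the opposite corner from a Leray/Type-I rate. [new here — MODEL/Euler exponent bookkeeping] -/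
theorem tendsto_velocityScale_zero_of_lt_half {α δ : ℝ} (T : ℝ) (hα : 0 < α) (hα2 : α < 1 / 2)
    (hδ : -(1 / 2) ≤ δ) :
    Tendsto (fun t : ℝ => (T - t) ^ (Elgindi.collapseExponent α δ - 1)) (𝓝[<] T) (𝓝 0) :=
  Elgindi.tendsto_velocityScale_zero T (one_lt_collapseExponent_of_lt_half hα hα2 hδ)

/-! ### The reversal bookkeeping of the δ-parametrised rows -/

/-- **The reversal threshold never reaches the wall**: for `2 + δ > 0` the characteristic-reversal threshold
`α_f(δ) = (1+δ)/(2(2+δ))` of `ElgindiGaugeCornerSpeed.cornerSpeed_E_pos_iff` satisfies `α_f(δ) < ½`. This is the identity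
by which the lead's letter (ee)(2)(e2) closes the «no reversal» bracket from above without a row at `α_E = ½`.
[new here — MODEL/Euler gauge algebra; Z6 SHEET v1 §6.1] -/
theorem cornerThreshold_lt_half {δ : ℝ} (h : 0 < 2 + δ) : (1 + δ) / (2 * (2 + δ)) < 1 / 2 := by
  rw [div_lt_iff₀ (by positivity)]
  linarith

/-- **Corner speed as a lower bound on `δ`**: for `α < ½` the axis-corner s-speed `(1+δ) − 2α(2+δ)`
(`ElgindiGaugeCornerSpeed.cornerSpeed_E`) is positive iff `(4α − 1)/(1 − 2α) < δ` — the first clause of the refuter's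
registered pre-statement P-Z6-10 («δ(α_E) > (4α_E−1)/(1−2α_E) at every converged row with α_E > ¼»).
[new here — MODEL/Euler gauge algebra; Z6 SHEET v1 §6.2] -/
theorem cornerSpeed_E_pos_iff_delta {α : ℝ} (hα : α < 1 / 2) (δ : ℝ) :
    0 < (1 + δ) - 2 * α * (2 + δ) ↔ (4 * α - 1) / (1 - 2 * α) < δ := by
  have h1 : 0 < 1 - 2 * α := by linarith
  rw [div_lt_iff₀ h1]
  constructor <;> intro h <;> nlinarith [h, h1]

/-- **The «reversal ratio» print**: for `¼ < α < ½` (where the threshold `(4α−1)/(1−2α)` is positive) the corner speed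
is positive iff the ratio `δ / ((4α−1)/(1−2α))` that engine A prints per δ-row exceeds `1` (census §1b: 2.53 → 1.69 on the
rows δ ∈ [3.37, 10]). [new here — MODEL/Euler gauge algebra; CENSUS-Z6 §1b] -/
theorem one_lt_reversalRatio_iff {α : ℝ} (hα4 : 1 / 4 < α) (hα : α < 1 / 2) (δ : ℝ) :
    1 < δ / ((4 * α - 1) / (1 - 2 * α)) ↔ 0 < (1 + δ) - 2 * α * (2 + δ) := by
  have h1 : 0 < 1 - 2 * α := by linarith
  have h2 : 0 < 4 * α - 1 := by linarith
  have hth : 0 < (4 * α - 1) / (1 - 2 * α) := div_pos h2 h1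
  rw [cornerSpeed_E_pos_iff_delta hα, lt_div_iff₀ hth, one_mul]

/-- **Far-field exponent = 1/c_l**: the profile's far-field law `F ∼ z^{−1/(1+δ)}` with `z = ρ^α` reads
`ω(T, x) ∼ |x|^{−α/(1+δ)}`, and `α/(1+δ) = 1/c_l` (as real-number identities this holds for all `α, δ` under the
field conventions). [new here — MODEL/Euler exponent bookkeeping; Z6 SHEET v1 §1.A «FAR FIELD», print n4] -/
theorem farFieldExponent_eq_inv_collapseExponent (α δ : ℝ) :
    α / (1 + δ) = 1 / Elgindi.collapseExponent α δ := by
  rw [Elgindi.collapseExponent_apply, one_div, inv_div]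

end ElgindiBranchKillSide
end Summit.NavierStokesRegularity.OSWSelfSimilar

end

/-! ## Appendix (ns-blowup-profile-eng-9 g2, 2026-08-27): the `C_eff` dictionary — one statistic carries both the
## no-reversal reading and the KILL margin

HONEST FRAMING as above: MODEL/Euler-gauge **real algebra**; nothing about solutions of the profile system is asserted.
The census file HOME/profile/z6/CENSUS-Z6.md §1b/§1c prints, per row, the statistic `C_eff := (1+δ)(½ − α_E)`
(0.656 at δ 3.37 ↑ 0.693 at δ 10 on engine A's δ-parametrised rows; 0.50 … 0.66 on the α_E-parametrised rows). WHAT IS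
KERNEL-CHECKED HERE (with `C_eff` always written out as `(1 + δ) * (1/2 − α)`, no definition introduced):
* `cornerSpeed_E_eq_two_mul_Ceff_sub`: the axis-corner s-speed of `ElgindiGaugeCornerSpeed.cornerSpeed_E` is
  `(1+δ) − 2α(2+δ) = 2·C_eff − 2α`; hence `cornerSpeed_E_pos_iff_lt_Ceff`: `m_char > 0 ↔ α < C_eff`, and
  `cornerSpeed_E_pos_of_half_lt_Ceff`: `α ≤ ½ ∧ ½ < C_eff ⇒ m_char > 0` — a characteristic REVERSAL before the wall
  `α_E = ½` needs `C_eff ≤ α_E < ½` (`Ceff_le_of_cornerSpeed_nonpos`), i.e. the printed statistic would have to FALL below `½`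
  from its last value 0.693 (census §0: «reversal ratio > 1 throughout» is the same fact);
* `half_lt_Ceff_iff`: `½ < C_eff ↔ 2α/(1−2α) < δ` for `α < ½`;
* `collapseExponent_eq_Ceff_div`: `c_l = (1+δ)/α = C_eff/(α(½−α))` (`α ≠ ½`), with `mul_half_sub_le_sixteenth`:
  `α(½−α) ≤ 1/16` (equality at `α = ¼`) ⇒ `sixteen_mul_Ceff_le_collapseExponent`: `16·C_eff ≤ c_l` on `0 < α < ½` for
  `C_eff ≥ 0`, and `eight_lt_collapseExponent_of_half_lt_Ceff`: `½ < C_eff ⇒ 8 < c_l`. This EXPLAINS the census's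
  «min c_l = 9.7059 at α_E = 0.25» without engine input beyond the slow variation of `C_eff`: at `α = ¼`,
  `c_l = 16·C_eff = 16 × 0.6066` exactly, and away from `¼` the factor `1/(α(½−α))` only grows.
WHAT IS NOT PROVED: monotonicity or any bound of `C_eff` along the branch (MODEL datum: two codes at α_E 0.25/0.30/0.35,
one code elsewhere); in particular «`C_eff > ½` on the whole branch» is the engines' reading, not a theorem.
bears_on: LADDER-NS N5/Z6 → N1 linear core (census §1b/§1c custody). Not NS.
-/

namespace Summit.NavierStokesRegularity.OSWSelfSimilar
namespace ElgindiBranchKillSide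

open Literature.Analysis.FluidPDE

/-- **Corner speed in terms of `C_eff`**: `(1+δ) − 2α(2+δ) = 2·((1+δ)(½ − α)) − 2α`.
[new here — MODEL/Euler gauge algebra; CENSUS-Z6 §1b] -/
theorem cornerSpeed_E_eq_two_mul_Ceff_sub (δ α : ℝ) :
    (1 + δ) - 2 * α * (2 + δ) = 2 * ((1 + δ) * (1 / 2 - α)) - 2 * α := by
  ring

/-- **No reversal iff `α < C_eff`**: the axis-corner s-speed is positive iff `α < (1+δ)(½ − α)`.
[new here — MODEL/Euler gauge algebra; CENSUS-Z6 §1b] -/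
theorem cornerSpeed_E_pos_iff_lt_Ceff (δ α : ℝ) :
    0 < (1 + δ) - 2 * α * (2 + δ) ↔ α < (1 + δ) * (1 / 2 - α) := by
  rw [cornerSpeed_E_eq_two_mul_Ceff_sub]
  constructor <;> intro h <;> linarith

/-- **`C_eff > ½` forbids reversal on the admissible range**: `α ≤ ½` and `½ < (1+δ)(½ − α)` ⇒ the corner speed is
positive. [new here — MODEL/Euler gauge algebra; CENSUS-Z6 §0/§1b] -/
theorem cornerSpeed_E_pos_of_half_lt_Ceff {δ α : ℝ} (hα : α ≤ 1 / 2) (h : 1 / 2 < (1 + δ) * (1 / 2 - α)) :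
    0 < (1 + δ) - 2 * α * (2 + δ) :=
  (cornerSpeed_E_pos_iff_lt_Ceff δ α).2 (lt_of_le_of_lt hα h)

/-- **A reversal needs `C_eff ≤ α`**: if the corner speed is `≤ 0` then `(1+δ)(½ − α) ≤ α` (so, before the wall `α < ½`,
the printed statistic must have dropped below `½`). [new here — MODEL/Euler gauge algebra; CENSUS-Z6 §1b] -/
theorem Ceff_le_of_cornerSpeed_nonpos {δ α : ℝ} (h : (1 + δ) - 2 * α * (2 + δ) ≤ 0) :
    (1 + δ) * (1 / 2 - α) ≤ α := by
  by_contra h'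
  exact absurd h (not_le.2 ((cornerSpeed_E_pos_iff_lt_Ceff δ α).2 (not_le.1 h')))

/-- **`C_eff > ½` as a lower bound on `δ`**: for `α < ½`, `½ < (1+δ)(½ − α) ↔ 2α/(1 − 2α) < δ`.
[new here — MODEL/Euler gauge algebra; CENSUS-Z6 §1c] -/
theorem half_lt_Ceff_iff {α : ℝ} (hα : α < 1 / 2) (δ : ℝ) :
    1 / 2 < (1 + δ) * (1 / 2 - α) ↔ 2 * α / (1 - 2 * α) < δ := by
  have h1 : 0 < 1 - 2 * α := by linarith
  rw [div_lt_iff₀ h1]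
  constructor <;> intro h <;> nlinarith [h, h1]

/-- **`c_l` through `C_eff`**: `(1+δ)/α = ((1+δ)(½ − α))/(α(½ − α))` for `α ≠ ½` (at `α = 0` both sides are `0` by
the field conventions). [new here — MODEL/Euler exponent bookkeeping; CENSUS-Z6 §1c] -/
theorem collapseExponent_eq_Ceff_div {α : ℝ} (hα2 : α ≠ 1 / 2) (δ : ℝ) :
    Elgindi.collapseExponent α δ = (1 + δ) * (1 / 2 - α) / (α * (1 / 2 - α)) := by
  have h : (1 / 2 : ℝ) - α ≠ 0 := sub_ne_zero.2 (Ne.symm hα2)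
  rw [Elgindi.collapseExponent_apply, mul_div_mul_right _ _ h]

/-- **AM–GM at the quarter point**: `α(½ − α) ≤ 1/16`, with equality at `α = ¼`.
[new here — elementary real algebra] -/
theorem mul_half_sub_le_sixteenth (α : ℝ) : α * (1 / 2 - α) ≤ 1 / 16 := by
  nlinarith [sq_nonneg (α - 1 / 4)]

/-- **The KILL margin carried by `C_eff`**: on `0 < α < ½`, if `0 ≤ (1+δ)(½ − α)` then `16·((1+δ)(½ − α)) ≤ c_l`
(equality of the factor at `α = ¼`: the census's «min c_l = 9.7059 at α_E = 0.25» is `16 × 0.6066`).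
[new here — MODEL/Euler exponent bookkeeping; CENSUS-Z6 §1c] -/
theorem sixteen_mul_Ceff_le_collapseExponent {α δ : ℝ} (hα : 0 < α) (hα2 : α < 1 / 2)
    (hC : 0 ≤ (1 + δ) * (1 / 2 - α)) :
    16 * ((1 + δ) * (1 / 2 - α)) ≤ Elgindi.collapseExponent α δ := by
  have hq : 0 < α * (1 / 2 - α) := mul_pos hα (by linarith)
  rw [collapseExponent_eq_Ceff_div (ne_of_lt hα2), le_div_iff₀ hq]
  have h16 := mul_half_sub_le_sixteenth α
  nlinarith [h16, hC]

/-- **`C_eff > ½` ⇒ `c_l > 8`** on the admissible range — a uniform explicit KILL-side margin from the one printed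
statistic. [new here — MODEL/Euler exponent bookkeeping; CENSUS-Z6 §0] -/
theorem eight_lt_collapseExponent_of_half_lt_Ceff {α δ : ℝ} (hα : 0 < α) (hα2 : α < 1 / 2)
    (h : 1 / 2 < (1 + δ) * (1 / 2 - α)) :
    8 < Elgindi.collapseExponent α δ := by
  have := sixteen_mul_Ceff_le_collapseExponent hα hα2 (le_of_lt (lt_trans (by norm_num) h))
  linarith

end ElgindiBranchKillSide
end Summit.NavierStokesRegularity.OSWSelfSimilar

/-! ## Appendix 2 (ns-blowup-profile-eng-9 g2, 2026-08-27): the large-δ outer balance and the drain-rate / tail-rate identity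

HONEST FRAMING as above: MODEL/Euler-gauge **real algebra and one-variable calculus**; nothing about solutions of the profile system is
asserted. Context: HOME/profile/z6/pen/LARGE-DELTA-STRUCTURE.md (eng-9 g2) and HOME/profile/z6twin/asym/README.md (eng-10 g5). On the
slow scale `S = s/(1+δ)` the stream function is `Φ = ε⁻¹a(S) sin 2θ + O(1)` (`ε = 1/(1+δ)`), so the `O(ε⁻¹)` part of the profile equation is
the ANGULAR balance `−6a F_u = 2a F` (`u = ln tan θ`: strain transport toward the plane against vortex stretching). WHAT IS KERNEL-CHECKED:
* `strainStretch_exp_solves_iff`: for `a ≠ 0`, `C ≠ 0` the exponential `u ↦ C e^{γu}` solves `6a y′ + 2a y = 0` at a point iff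
  `γ = −1/3` — the plane-side law `F ∝ e^{−u/3} = (cot θ)^{1/3}` that engine A's δ-rows show (d ln F/du → −⅓);
* `outerPlane_H_exponent`: in `H = F/(Γ m)` with `Γ ∝ e^{αu/3}` near the plane this reads `d ln H/du = −1/3 − α/3 = −(1+α)/3`
  (the «edge H-exponent» −0.445 … −0.487 of the census vs −0.450 … −0.479);
* `axisClass_defect`: the class law `e^{−2αu/3}` (axis side, five digits in the states) leaves the defect
  `−6a·(−2α/3) − 2a = 2a(2α − 1)` in that balance, and `axisClass_defect_eq_Ceff`: `2a(2α−1) = −4a·C_eff·ε` with `C_eff = (1+δ)(½ − α)`,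
  `ε(1+δ) = 1` — so the defect is `O(ε)` relative to the `O(ε⁻¹)` balance, i.e. absorbable at `O(1)`, exactly when `C_eff = O(1)`
  (the reading «α* = ½ with C_eff bounded is forced by axis-order matching» rests on this algebra plus the engines' MODEL datum);
* `drainRate_sub_tailRate`: the REDUCED model's phase-2 drain rate of `F` per unit `s`, `(1−2α)/(2α)` (eng-10 README §4: `(ln H)_s → −1/(2α)`
  in the class `F = Γ z H`), minus the exact far-tail rate `1/(1+δ)` equals `m_char/(2α(1+δ))` with `m_char = (1+δ) − 2α(2+δ)`
  (`ElgindiGaugeCornerSpeed.cornerSpeed_E`); hence `drainRate_eq_tailRate_iff`: the two rates coincide iff `m_char = 0` — a profile whose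
  interior drain law persists to the tail sits EXACTLY on the characteristic-reversal line, and `drainRate_gt_tailRate_iff`: drain faster than
  the tail iff `m_char > 0`.
WHAT IS NOT PROVED: that either rate law holds for the profile (MODEL read-outs: engine A's rows show `−(ln F)_s ↑ ε` behind the peak and never
above it at δ ≤ 10; the reduced model's phase-2 law is eng-10's pen); existence of profiles. bears_on: LADDER-NS N5/Z6 case Z6-1 (c),
P-Z6-6 / P-Z6-10 → N1 linear core. Not NS.
-/

namespace Summit.NavierStokesRegularity.OSWSelfSimilar
namespace ElgindiBranchKillSide

open Literature.Analysis.FluidPDE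

/-- **The strain–stretching balance selects the exponent `−1/3`.** For `a ≠ 0`, `C ≠ 0` and any `u`, the function `y(u) = C e^{γu}`
(with `y′(u) = γ C e^{γu}`) satisfies `6a·y′(u) + 2a·y(u) = 0` iff `γ = −1/3`. [new here — MODEL/Euler gauge algebra;
LARGE-DELTA-STRUCTURE §2] -/
theorem strainStretch_exp_solves_iff {a C γ : ℝ} (ha : a ≠ 0) (hC : C ≠ 0) (u : ℝ) :
    6 * a * (γ * (C * Real.exp (γ * u))) + 2 * a * (C * Real.exp (γ * u)) = 0 ↔ γ = -(1 / 3) := by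
  have hE : Real.exp (γ * u) ≠ 0 := Real.exp_ne_zero _
  have key : 6 * a * (γ * (C * Real.exp (γ * u))) + 2 * a * (C * Real.exp (γ * u))
      = (2 * a * C * Real.exp (γ * u)) * (3 * γ + 1) := by ring
  rw [key, mul_eq_zero]
  constructor
  · rintro (h | h)
    · exact absurd h (mul_ne_zero (mul_ne_zero (mul_ne_zero two_ne_zero ha) hC) hE)
    · linarith
  · intro h; right; linarith

/-- **The exponential really has that derivative**: `d/du (C e^{γu}) = γ C e^{γu}` (so the previous lemma is about a genuine solution of
the ODE `6a y′ + 2a y = 0`). [new here — one-variable calculus] -/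
theorem hasDerivAt_const_mul_exp (C γ u : ℝ) :
    HasDerivAt (fun v : ℝ => C * Real.exp (γ * v)) (γ * (C * Real.exp (γ * u))) u := by
  have h1 : HasDerivAt (fun v : ℝ => γ * v) γ u := by
    simpa using (hasDerivAt_id u).const_mul γ
  have h2 : HasDerivAt (fun v : ℝ => Real.exp (γ * v)) (Real.exp (γ * u) * γ) u := h1.exp
  have h3 : HasDerivAt (fun v : ℝ => C * Real.exp (γ * v)) (C * (Real.exp (γ * u) * γ)) u := h2.const_mul C
  exact h3.congr_deriv (by ring)

/-- **Plane-side `H`-exponent**: with `F ∝ e^{−u/3}` and the class weight `Γ ∝ e^{αu/3}` near the plane, `H = F/(Γm)` has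
`d ln H/du = −1/3 − α/3 = −(1+α)/3`. [new here — MODEL/Euler exponent bookkeeping; CENSUS-Z6 §1c «edge H-exponent»] -/
theorem outerPlane_H_exponent (α : ℝ) : -(1 / 3 : ℝ) - α / 3 = -((1 + α) / 3) := by
  ring

/-- **Defect of the axis-side class law in the outer balance**: substituting `y = e^{−2αu/3}` (so `y′ = −(2α/3)y`) into `6a y′ + 2a y`
leaves `2a(1 − 2α)·y`; equivalently `−6a(−2α/3) − 2a = 2a(2α − 1)` (written for `−6aF_u − 2aF`). [new here — MODEL/Euler gauge
algebra; LARGE-DELTA-STRUCTURE §2] -/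
theorem axisClass_defect (a α : ℝ) : -(6 * a * (-(2 * α / 3))) - 2 * a = 2 * a * (2 * α - 1) := by
  ring

/-- **The defect is `O(ε)` exactly when `C_eff = O(1)`**: `2a(2α − 1) = −4a·((1+δ)(½ − α))·ε` whenever `ε(1+δ) = 1`.
[new here — MODEL/Euler gauge algebra; LARGE-DELTA-STRUCTURE §2] -/
theorem axisClass_defect_eq_Ceff {δ ε : ℝ} (hε : ε * (1 + δ) = 1) (a α : ℝ) :
    2 * a * (2 * α - 1) = -(4 * a * ((1 + δ) * (1 / 2 - α)) * ε) := by
  have : 2 * a * (2 * α - 1) = 2 * a * (2 * α - 1) * (ε * (1 + δ)) := by rw [hε, mul_one]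
  rw [this]; ring

/-- **Drain rate minus tail rate.** The reduced model's phase-2 decay rate of `F` per unit `s`, `(1 − 2α)/(2α)`, minus the exact far-tail
rate `1/(1+δ)` equals `m_char/(2α(1+δ))` with `m_char = (1+δ) − 2α(2+δ)` (`α ≠ 0`, `1 + δ ≠ 0`).
[new here — MODEL/Euler gauge algebra; RATES.txt / eng-10 README §4] -/
theorem drainRate_sub_tailRate {α δ : ℝ} (hα : α ≠ 0) (hδ : 1 + δ ≠ 0) :
    (1 - 2 * α) / (2 * α) - 1 / (1 + δ) = ((1 + δ) - 2 * α * (2 + δ)) / (2 * α * (1 + δ)) := by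
  field_simp
  ring

/-- **Drain rate = tail rate iff on the reversal line** (`m_char = 0`), for `α ≠ 0`, `1 + δ ≠ 0`.
[new here — MODEL/Euler gauge algebra] -/
theorem drainRate_eq_tailRate_iff {α δ : ℝ} (hα : α ≠ 0) (hδ : 1 + δ ≠ 0) :
    (1 - 2 * α) / (2 * α) = 1 / (1 + δ) ↔ (1 + δ) - 2 * α * (2 + δ) = 0 := by
  rw [← sub_eq_zero, drainRate_sub_tailRate hα hδ, div_eq_zero_iff]
  constructor
  · rintro (h | h)
    · exact h
    · exact absurd h (mul_ne_zero (mul_ne_zero two_ne_zero hα) hδ)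
  · intro h; exact Or.inl h

/-- **Drain faster than the tail iff `m_char > 0`** (for `α > 0`, `1 + δ > 0`): the interior phase-2 law decays faster than the far
tail exactly on the inflow side of the reversal line — so a profile carrying BOTH laws has a log-convex `F(s)` behind its peak, whereas
engine A's full-model rows at `δ ≤ 10` show `−(ln F)_s` increasing monotonically up to the tail rate (log-concave); the pair is the twin
question put to eng-10 (STATUS 2026-08-27 ≈09:4xZ). [new here — MODEL/Euler gauge algebra] -/
theorem drainRate_gt_tailRate_iff {α δ : ℝ} (hα : 0 < α) (hδ : 0 < 1 + δ) :
    1 / (1 + δ) < (1 - 2 * α) / (2 * α) ↔ 0 < (1 + δ) - 2 * α * (2 + δ) := by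
  rw [← sub_pos, drainRate_sub_tailRate hα.ne' hδ.ne']
  constructor
  · intro h
    by_contra h'
    have : ((1 + δ) - 2 * α * (2 + δ)) / (2 * α * (1 + δ)) ≤ 0 :=
      div_nonpos_of_nonpos_of_nonneg (not_lt.1 h') (by positivity)
    linarith
  · intro h; positivity

end ElgindiBranchKillSide
end Summit.NavierStokesRegularity.OSWSelfSimilar
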